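import Literature.NumberTheory.EllipticCurves.HeegnerPointsKolyvaginPrimaryCebotarevFrobeniusProofs
import HarnessLib

/-!
# Route `PrintCFram`, crux C2 `BottomClassIndexLawFiveLe` (stmt-BirchSwinnertonDyer-20372), road II
# (`borel_heegner_squeeze` S2 `stub_kolyvaginUpper_borelCM`): **KOLYVAGIN PRIMES OF THE SECOND
# FROBENIUS TYPE** — the Čebotarev step for a Galois element `ρ` that need NOT fix `E[p^M]`
# (only `ρ^τ ρ` must), the evaluation identity `[x, (ρm)^τ(ρm)] = [x, ρ^τρ] + [x, m] − ν τ[x, m]`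
# for `ρ` acting as `−1`, and McCallum's congruences `p^M ∣ ℓ + 1`, `p^M ∣ a_ℓ` for such primes
# (cell `bsd-print-cfram`, width seat `bsd-line-cfram-p1-w5` g12; helper `--supports` 20372;
# 0 facts, 0 defs, 0 sorry)

HONEST FRAMING. Nothing about BSD is proved here, and nothing of the stub itself. This file and its
sibling `…BorelTypeTwoVisibility` correct ONE reading on the crux's record. Gross 1991 (3.2) asks of a
Kolyvagin prime `ℓ` that `Frob(ℓ) = Frob(∞)` in `Gal(K(E_{p^M})/ℚ)`; the tree's `IsKolyvaginPrime`
records (3.2) verbatim (`FrobEqFrobInfty`), and every Čebotarev producer of the tree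
(`exists_kolyvaginPrime_gt_of_galoisElement` and its consumers in the `…Borel*` files) manufactures
primes with `Frob(ℓ) ∼ c₀ · g`, `g ∈ Γ_{K(E[p^M])}`. McCallum 1991 §4 / Kolyvagin 1990 use of `ℓ` only
the CONGRUENCES `p^M ∣ ℓ + 1`, `p^M ∣ a_ℓ` (and `ℓ` inert, `ℓ ∤ N d p`). When `ρ̄_{E,p}` is onto the
two are the same condition; at the Borel CM-ramified prime they are NOT: the elements of
`Gal(K(E[p^M])/ℚ)` with characteristic polynomial `X² − 1` contain, besides the class of `c₀`, the
class of `c₀ · z` for any `z ∈ Γ_K` acting on `E[p^M]` as `−1` — and `c₀ z` is not conjugate to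
`c₀` there (the scalar part of the image on the line `W[𝔭]` separates them). This file supplies the
image-free machinery for such primes:

* §1 (any field, any curve, any `n`): for `ρ ∈ Γ_K` acting on `E[n]` as `−1` and an involutive
  lift `τ` of `σ`, `ρ^τ := τ⁻¹ρτ` acts as `−1` (`smul_eq_neg_of_conjGalCMH`), `ρ^τ ρ ∈ Γ_{K(E[n])}`
  (`conjGalCMH_mul_mem_torsionFixing_of_smul_eq_neg`), and for a `σ_*`-eigenclass `x` (sign `ν`)
  and `m ∈ Γ_{K(E[n])}`:
  **`[x, (ρm)^τ(ρm)] = [x, ρ^τρ] + ([x, m] − ν τ[x, m])`** (`h1Eval_conjGalCMH_mul_mul_of_smul_eq_neg`)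
  — compare the type-one identity `[x, m^τ m] = [x, m] + ν τ[x, m]` of `…BorelKolyvaginVisibility`:
  the sign in front of `ν τ` FLIPS. Hence a class all of whose values are `(−ν)`-eigen for `τ`
  (INVISIBLE to type-one primes) has `[x, (ρm)^τ(ρm)] = [x, ρ^τρ] + 2[x, m]`
  (`…_of_antiEigen`), while a class with `ν`-eigen values has the CONSTANT evaluation `[x, ρ^τρ]`
  (`…_of_sameEigen`).
* §2 `exists_prime_gt_of_galoisElement_of_conjGalCMH_mul_mem` — the tree's image-free Čebotarev step
  (`HeegnerPointsKolyvaginPrimaryCebotarevFrobeniusProofs`, Steps C–G verbatim) with the hypothesis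
  `ρ ∈ Γ_{K(E[p^M])}` RELAXED to `ρ^τ ρ ∈ Γ_{K(E[p^M])}`: a prime `ℓ > b`, `ℓ ∤ N d_K p`, `(ℓ)` prime
  in `𝓞 K`, an arithmetic Frobenius above `ℓ` EQUAL to `c₀ · res(ρm)` for some `m ∈ 𝒩`, and
  McCallum's local criterion `x_λ = 0 ⟺ [x, (ρm)^τ(ρm)] = 0` on the span of the given classes. The
  conclusion no longer contains `FrobEqFrobInfty` (it is false for these primes in general).
* The sibling `…BorelTypeTwoVisibility` adds: McCallum's congruences `p^M ∣ ℓ + 1`, `p^M ∣ a_ℓ` at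
  such a prime when `ρ` acts as `−1` (the Frobenius acts on `E(ℚ̄)[p^M]` as `−c₀`, still inverting
  `μ_{p^M}`), the TYPE-TWO VISIBILITY theorem (a class invisible to every (3.2)-prime is seen, at a
  numerically-Kolyvagin prime above every bound, as soon as some `z ∈ Γ_K` acts on `E[p^M]` as `−1`),
  and its instance in the binders of `…BorelKolyvaginBlind` (those primes violate (3.2)).

THEOREMS ONLY; no definition, no named fact, no `sorry`; inputs: the Čebotarev density theorem
(`Automorphic.chebotarev_artinRep`, as in the tree) and the Weil pairing (proved in the tree). BSD is
not proved by any of this; no summit statement is proved by this seat; no stub is closed.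
References: [McCallumLMS1991] §3 Prop. 3.1 (proof), (3); §4 (Kolyvagin primes of level `M`);
[GrossLMS1991] §3 (3.1)–(3.3), §9; [KolyvaginEulerSystems1990] §1.
-/

set_option autoImplicit false
-- `…BirchSwinnertonDyer.BirchSwinnertonDyer.Theorems…` is the problem's mandated namespace (D-0017).
set_option linter.dupNamespace false

noncomputable section

open scoped Classical Pointwise

namespace Summit.BirchSwinnertonDyer.BirchSwinnertonDyer.Theorems.PrintCFram.BorelTypeTwo

open WeierstrassCurve NumberField IsDedekindDomain Field Literature.NumberTheory.EllipticCurves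
  Literature.NumberTheory.GaloisRepresentations

universe u v

/-! ## §1 `ρ` acting as `−1`: `ρ^τ ρ` fixes `E[n]`, and the evaluation identity -/

section Algebra

variable {k : Type v} {K : Type u} [Field k] [Field K] [Algebra k K] (W : WeierstrassCurve k)
variable {σ : K ≃ₐ[k] K} {τ : AlgebraicClosure K ≃+* AlgebraicClosure K}

/-- **`ρ^τ = τ⁻¹ρτ` acts on `E[n]` as `−1` when `ρ` does** (`τ(ρ^τ P) = ρ(τ P) = −τ P`, and `τ` is
an additive involution on `E[n]`). [folklore] -/
theorem smul_eq_neg_of_conjGalCMH (hτ : IsLiftOfAut σ τ) (hinv : ∀ x, τ (τ x) = x) (n : ℤ)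
    {ρ : absoluteGaloisGroup K} (hρ : ∀ P : geomTorsion (W.baseChange K) n, ρ • P = -P)
    (P : geomTorsion (W.baseChange K) n) : hτ.conjGalCMH ρ • P = -P := by
  apply hτ.torsionMap_injective W hinv n
  rw [hτ.torsionMap_smul W n, hρ, map_neg]

/-- **`ρ^τ ρ ∈ Γ_{K(E[n])}` when `ρ` acts on `E[n]` as `−1`** (`(−1)(−1) = 1`). [folklore] -/
theorem conjGalCMH_mul_mem_torsionFixing_of_smul_eq_neg (hτ : IsLiftOfAut σ τ)
    (hinv : ∀ x, τ (τ x) = x) (n : ℤ) {ρ : absoluteGaloisGroup K}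
    (hρ : ∀ P : geomTorsion (W.baseChange K) n, ρ • P = -P) :
    hτ.conjGalCMH ρ * ρ ∈ torsionFixing (W.baseChange K) n := by
  refine (mem_torsionFixing_iff _ n).mpr fun P ↦ ?_
  rw [mul_smul, hρ, smul_neg, smul_eq_neg_of_conjGalCMH W hτ hinv n hρ, neg_neg]

/-- `(ρm)^τ (ρm) ∈ Γ_{K(E[n])}` for `ρ` acting as `−1` and `m ∈ Γ_{K(E[n])}`. [folklore] -/
theorem conjGalCMH_mul_mul_mem_torsionFixing_of_smul_eq_neg (hτ : IsLiftOfAut σ τ)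
    (hinv : ∀ x, τ (τ x) = x) (n : ℤ) {ρ : absoluteGaloisGroup K}
    (hρ : ∀ P : geomTorsion (W.baseChange K) n, ρ • P = -P) {m : absoluteGaloisGroup K}
    (hm : m ∈ torsionFixing (W.baseChange K) n) :
    hτ.conjGalCMH (ρ * m) * (ρ * m) ∈ torsionFixing (W.baseChange K) n := by
  refine (mem_torsionFixing_iff _ n).mpr fun P ↦ ?_
  rw [map_mul, mul_smul, mul_smul, mul_smul, smul_eq_of_mem_torsionFixing _ n hm, hρ, smul_neg,
    smul_eq_of_mem_torsionFixing _ n (hτ.conjGalCMH_mem_torsionFixing W hinv n hm),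
    smul_eq_neg_of_conjGalCMH W hτ hinv n hρ, neg_neg]

/-- **More generally: `ρ^τ ρ ∈ Γ_{K(E[n])}` implies `(ρm)^τ(ρm) ∈ Γ_{K(E[n])}` for
`m ∈ Γ_{K(E[n])}`** (`(ρm)^τ(ρm) = [ρ^τ m^τ (ρ^τ)⁻¹] · (ρ^τρ) · m`, three elements of the normal
subgroup `Γ_{K(E[n])}`). [folklore] -/
theorem conjGalCMH_mul_mul_mem_torsionFixing (hτ : IsLiftOfAut σ τ) (hinv : ∀ x, τ (τ x) = x)
    (n : ℤ) {ρ : absoluteGaloisGroup K}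
    (hρ2 : hτ.conjGalCMH ρ * ρ ∈ torsionFixing (W.baseChange K) n) {m : absoluteGaloisGroup K}
    (hm : m ∈ torsionFixing (W.baseChange K) n) :
    hτ.conjGalCMH (ρ * m) * (ρ * m) ∈ torsionFixing (W.baseChange K) n := by
  have hA : hτ.conjGalCMH ρ * hτ.conjGalCMH m * (hτ.conjGalCMH ρ)⁻¹ ∈
      torsionFixing (W.baseChange K) n :=
    (torsionFixing_normal (W.baseChange K) n).conj_mem _
      (hτ.conjGalCMH_mem_torsionFixing W hinv n hm) _
  have heq : hτ.conjGalCMH (ρ * m) * (ρ * m) =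
      (hτ.conjGalCMH ρ * hτ.conjGalCMH m * (hτ.conjGalCMH ρ)⁻¹) * (hτ.conjGalCMH ρ * ρ) * m := by
    rw [map_mul]; group
  rw [heq]
  exact mul_mem (mul_mem hA hρ2) hm

/-- **The type-two evaluation identity.** For a `σ_*`-eigenclass `x` (`σ_* x = ν x`, `ν = ±1`), an
involutive lift `τ` of `σ`, `ρ ∈ Γ_K` acting on `E[n]` as `−1` and `m ∈ Γ_{K(E[n])}`:
**`[x, (ρm)^τ (ρm)] = [x, ρ^τ ρ] + ([x, m] − ν τ[x, m])`.** Proof: `(ρm)^τ(ρm) = A · (ρ^τρ) · m` with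
`A = ρ^τ m^τ (ρ^τ)⁻¹`, all three fixing `E[n]`; `[x, A] = ρ^τ · [x, m^τ] = −[x, m^τ]` (Gross's
equivariance `[x, gρg⁻¹] = g[x, ρ]`) and `[x, m^τ] = ν τ[x, m]` (the eigen-evaluation of the tree).
Compare `[x, m^τ m] = [x, m] + ν τ[x, m]` (`…BorelKolyvaginVisibility`): the `τ`-term changes sign.
[cite: McCallumLMS1991, §3 proof of Prop. 3.1] -/
theorem h1Eval_conjGalCMH_mul_mul_of_smul_eq_neg (hτ : IsLiftOfAut σ τ) (hinv : ∀ x, τ (τ x) = x)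
    (n : ℤ) {x : galH1Torsion (W.baseChange K) n} {ν : ℤ} (hν : ν = 1 ∨ ν = -1)
    (hx : conjAct W σ n x = ν • x) {ρ : absoluteGaloisGroup K}
    (hρ : ∀ P : geomTorsion (W.baseChange K) n, ρ • P = -P) {m : absoluteGaloisGroup K}
    (hm : m ∈ torsionFixing (W.baseChange K) n) :
    h1Eval (W.baseChange K) n x (hτ.conjGalCMH (ρ * m) * (ρ * m)) =
      h1Eval (W.baseChange K) n x (hτ.conjGalCMH ρ * ρ) +
        (h1Eval (W.baseChange K) n x m - ν • hτ.torsionMap W n (h1Eval (W.baseChange K) n x m)) := by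
  have hmτ : hτ.conjGalCMH m ∈ torsionFixing (W.baseChange K) n :=
    hτ.conjGalCMH_mem_torsionFixing W hinv n hm
  have hA : hτ.conjGalCMH ρ * hτ.conjGalCMH m * (hτ.conjGalCMH ρ)⁻¹ ∈
      torsionFixing (W.baseChange K) n :=
    (torsionFixing_normal (W.baseChange K) n).conj_mem _ hmτ _
  have hρ2 := conjGalCMH_mul_mem_torsionFixing_of_smul_eq_neg W hτ hinv n hρ
  have heq : hτ.conjGalCMH (ρ * m) * (ρ * m) =
      (hτ.conjGalCMH ρ * hτ.conjGalCMH m * (hτ.conjGalCMH ρ)⁻¹) * ((hτ.conjGalCMH ρ * ρ) * m) := by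
    rw [map_mul]; group
  rw [heq, h1Eval_mul _ n x hA, h1Eval_mul _ n x hρ2, h1Eval_conj _ n x _ hmτ,
    smul_eq_neg_of_conjGalCMH W hτ hinv n hρ, hτ.h1Eval_conjGalCMH_of_eigen W hinv n hν hx hm]
  abel

/-- **Type two, INVISIBLE-to-type-one classes are seen.** If every value `[x, g]`
(`g ∈ Γ_{K(E[n])}`) of the `σ_*`-eigenclass `x` (sign `ν`) is a `(−ν)`-eigenvector of `τ` — the
hypothesis under which `[x, m^τ m] = 0` for ALL `m` (`h1Eval_conjGalCMH_mul_eq_zero_of_antiEigen` of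
`…BorelKolyvaginVisibility`) — then for `ρ` acting as `−1`:
**`[x, (ρm)^τ(ρm)] = [x, ρ^τρ] + 2[x, m]`.** [cite: McCallumLMS1991, §3 (2)–(3)] -/
theorem h1Eval_conjGalCMH_mul_mul_of_smul_eq_neg_of_antiEigen (hτ : IsLiftOfAut σ τ)
    (hinv : ∀ x, τ (τ x) = x) (n : ℤ) {x : galH1Torsion (W.baseChange K) n} {ν : ℤ}
    (hν : ν = 1 ∨ ν = -1) (hx : conjAct W σ n x = ν • x) {ρ : absoluteGaloisGroup K}
    (hρ : ∀ P : geomTorsion (W.baseChange K) n, ρ • P = -P)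
    (hvals : ∀ g ∈ torsionFixing (W.baseChange K) n,
      hτ.torsionMap W n (h1Eval (W.baseChange K) n x g) = -(ν • h1Eval (W.baseChange K) n x g))
    {m : absoluteGaloisGroup K} (hm : m ∈ torsionFixing (W.baseChange K) n) :
    h1Eval (W.baseChange K) n x (hτ.conjGalCMH (ρ * m) * (ρ * m)) =
      h1Eval (W.baseChange K) n x (hτ.conjGalCMH ρ * ρ) + (2 : ℤ) • h1Eval (W.baseChange K) n x m := by
  rw [h1Eval_conjGalCMH_mul_mul_of_smul_eq_neg W hτ hinv n hν hx hρ hm, hvals m hm, smul_neg,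
    smul_smul]
  have hνν : ν * ν = 1 := by rcases hν with rfl | rfl <;> norm_num
  rw [hνν, one_smul, sub_neg_eq_add, two_zsmul]

/-- **Type two, classes with `ν`-eigen values have a CONSTANT evaluation.** If every value of the
`σ_*`-eigenclass `x` (sign `ν`) is a `ν`-eigenvector of `τ` (the classes that type-one primes see at
full order, `[x, m^τ m] = 2[x, m]`), then for `ρ` acting as `−1` the evaluation
`[x, (ρm)^τ(ρm)] = [x, ρ^τ ρ]` does not depend on `m ∈ Γ_{K(E[n])}`. [cite: McCallumLMS1991, §3 (2)–(3)] -/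
theorem h1Eval_conjGalCMH_mul_mul_of_smul_eq_neg_of_sameEigen (hτ : IsLiftOfAut σ τ)
    (hinv : ∀ x, τ (τ x) = x) (n : ℤ) {x : galH1Torsion (W.baseChange K) n} {ν : ℤ}
    (hν : ν = 1 ∨ ν = -1) (hx : conjAct W σ n x = ν • x) {ρ : absoluteGaloisGroup K}
    (hρ : ∀ P : geomTorsion (W.baseChange K) n, ρ • P = -P)
    (hvals : ∀ g ∈ torsionFixing (W.baseChange K) n,
      hτ.torsionMap W n (h1Eval (W.baseChange K) n x g) = ν • h1Eval (W.baseChange K) n x g)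
    {m : absoluteGaloisGroup K} (hm : m ∈ torsionFixing (W.baseChange K) n) :
    h1Eval (W.baseChange K) n x (hτ.conjGalCMH (ρ * m) * (ρ * m)) =
      h1Eval (W.baseChange K) n x (hτ.conjGalCMH ρ * ρ) := by
  rw [h1Eval_conjGalCMH_mul_mul_of_smul_eq_neg W hτ hinv n hν hx hρ hm, hvals m hm, smul_smul]
  have hνν : ν * ν = 1 := by rcases hν with rfl | rfl <;> norm_num
  rw [hνν, one_smul, sub_self, add_zero]

/-- **Adjusting `ρ` inside its coset: `[x, (ρg)^τ(ρg)]` for the blind configuration.** With `x`,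
`ρ` as in `…_of_antiEigen` and `g ∈ Γ_{K(E[n])}`, the element `ρ' = ρg` again acts as `−1`, and
`[x, ρ'^τ ρ'] = [x, ρ^τρ] + 2[x, g]`; so if `[x, ρ^τρ] = 0` and `2[x, g] ≠ 0` then `[x, ρ'^τρ'] ≠ 0`.
Used to pick, for a non-zero blind class, a `ρ` acting as `−1` that SEES it. [folklore] -/
theorem smul_eq_neg_mul_of_mem_torsionFixing (n : ℤ) {ρ : absoluteGaloisGroup K}
    (hρ : ∀ P : geomTorsion (W.baseChange K) n, ρ • P = -P) {g : absoluteGaloisGroup K}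
    (hg : g ∈ torsionFixing (W.baseChange K) n) (P : geomTorsion (W.baseChange K) n) :
    (ρ * g) • P = -P := by
  rw [mul_smul, smul_eq_of_mem_torsionFixing _ n hg, hρ]

end Algebra

/-! ## §2 The Čebotarev step for `ρ` with `ρ^τ ρ ∈ Γ_{K(E[p^M])}` (image-free) -/

section Cebotarev

variable {W : WeierstrassCurve ℚ} {K : Type u} [Field K] [NumberField K]

/-- **A prime above any bound whose Frobenius is `c₀ · res(ρm)`, `m ∈ 𝒩`, with McCallum's local
criterion on the span of the given classes — for ANY `ρ ∈ Γ_K` with `ρ^τ ρ ∈ Γ_{K(E[p^M])}`.** This is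
the tree's `exists_kolyvaginPrime_gt_of_galoisElement` (McCallum 1991, proof of Prop. 3.1, Steps C–G)
with its hypothesis `ρ ∈ Γ_{K(E[p^M])}` relaxed to `ρ^τ ρ ∈ Γ_{K(E[p^M])}` (so that the Frobenius
`(ρm)^τ(ρm)` of the place `λ ∋ ℓ` still fixes `E[p^M]`), and with Gross's (3.2)
`Frob(ℓ) = Frob(∞)` REMOVED from the conclusion (it fails when `ρ` acts as `−1`); instead the
conclusion RETURNS the Frobenius datum: a place `v ∋ ℓ` of `ℚ`, a prime `𝔓₀` of `\bar ℤ` above it,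
and `IsArithFrobAt (c₀ · res(ρm)) 𝔓₀`. For `K` imaginary quadratic with complex conjugation `c`
lifted along `c₀`, `p` prime, classes `c_i ∈ H¹(K, E[p^M])`, and any bound `b`: a prime `ℓ > b`,
`ℓ ∤ N`, `ℓ ∤ d_K`, `ℓ ≠ p`, `(ℓ)` prime in `𝓞 K`, and `m ∈ 𝒩` (all `[c_i, m] = 0`) with
`x_λ = 0 ⟺ [x, (ρm)^τ(ρm)] = 0` at every place `λ ∋ ℓ` of `K`, for all `x ∈ ⟨c_i⟩`. Proof: the tree's
Steps C–G line by line (finite exceptional set; a Frobenius in the open set `c₀ · res(ρ𝒩)` by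
density; inertness of `ℓ` from `c₀ · res(ρm) ∉ res Γ_K`, with Frobenius `(c₀·res(ρm))² = res((ρm)^τ(ρm))`
over `K`; the local criterion `mem_torsionLocalKer_iff_h1Eval_eq_zero`).
[cite: McCallumLMS1991, §3 Prop. 3.1 (proof), (3)] -/
theorem exists_prime_gt_of_galoisElement_of_conjGalCMH_mul_mem
    (hC : Literature.NumberTheory.Automorphic.chebotarev_artinRep) {N : ℕ}
    [NeZero N] [W.IsElliptic] (hK : IsImaginaryQuadratic K) {p : ℕ} (hp : p.Prime) {M : ℕ}
    {c : K ≃ₐ[ℚ] K} {c₀ : absoluteGaloisGroup ℚ} (hc₀ : IsComplexConjugation (Rat.castHom ℝ) c₀)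
    (ht : IsLiftOfAut c (absGaloisTransport (K := ℚ) (L := K) c₀).toRingEquiv)
    (hinv : ∀ x, (absGaloisTransport (K := ℚ) (L := K) c₀).toRingEquiv
      ((absGaloisTransport (K := ℚ) (L := K) c₀).toRingEquiv x) = x)
    {ι : Type*} [Fintype ι] (cs : ι → galH1Torsion (W.baseChange K) ((p ^ M : ℕ) : ℤ))
    {ρ : absoluteGaloisGroup K}
    (hρ2 : ht.conjGalCMH ρ * ρ ∈ torsionFixing (W.baseChange K) ((p ^ M : ℕ) : ℤ)) (b : ℕ) :
    ∃ ℓ : ℕ, b < ℓ ∧ ℓ.Prime ∧ ¬ ℓ ∣ N ∧ ¬ ((ℓ : ℤ) ∣ NumberField.discr K) ∧ ℓ ≠ p ∧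
      (Ideal.span {(ℓ : 𝓞 K)}).IsPrime ∧
      ∃ m ∈ evalKer (W.baseChange K) ((p ^ M : ℕ) : ℤ) cs,
        (∃ (v : HeightOneSpectrum (𝓞 ℚ)) (𝔓₀ : Ideal (absIntegers (𝓞 ℚ) ℚ)),
          (ℓ : 𝓞 ℚ) ∈ v.asIdeal ∧ 𝔓₀ ∈ v.primesAbove ∧
            IsArithFrobAt (𝓞 ℚ) (c₀ * absGaloisRestrict ℚ K (ρ * m)) 𝔓₀) ∧
        ∀ x ∈ AddSubgroup.closure (Set.range cs),
          ∀ v : HeightOneSpectrum (𝓞 K), (ℓ : 𝓞 K) ∈ v.asIdeal →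
            (x ∈ (W.baseChange K).torsionLocalKer (v.adicCompletion K) ((p ^ M : ℕ) : ℤ) ↔
              h1Eval (W.baseChange K) ((p ^ M : ℕ) : ℤ) x (ht.conjGalCMH (ρ * m) * (ρ * m)) = 0) := by
  classical
  haveI : Fact p.Prime := ⟨hp⟩
  haveI : Algebra.IsQuadraticExtension ℚ K := ⟨hK.1⟩
  haveI : IsTotallyComplex K := hK.2
  have hn0 : ((p ^ M : ℕ) : ℤ) ≠ 0 := by exact_mod_cast pow_ne_zero M hp.ne_zero
  -- ### Step C: the finite exceptional set of places of `ℚ`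
  have hbad : ((W.baseChange K).badPlaces (𝓞 K)).Finite :=
    (W.baseChange K).finite_badPlaces_holds (𝓞 K)
  choose T hTfin hT using fun i ↦
    exists_finite_forall_mem_unramifiedKer (W.baseChange K) hn0 (cs i)
  set B : Finset ℕ := {p} ∪ N.primeFactors ∪ (NumberField.discr K).natAbs.primeFactors ∪
    Finset.range (b + 1) with hB
  set S₁ : Set (HeightOneSpectrum (𝓞 ℚ)) := {v | ∃ q ∈ B, q.Prime ∧ (q : 𝓞 ℚ) ∈ v.asIdeal}
    with hS₁
  set S₂ : Set (HeightOneSpectrum (𝓞 ℚ)) := {v | ¬ Algebra.IsUnramifiedIn (𝓞 K) v.asIdeal}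
    with hS₂
  set S₃ : Set (HeightOneSpectrum (𝓞 ℚ)) :=
    (fun w : HeightOneSpectrum (𝓞 K) ↦ w.under (𝓞 ℚ)) ''
      ((W.baseChange K).badPlaces (𝓞 K) ∪ ⋃ i, T i) with hS₃
  have hS₁fin : S₁.Finite := by
    have : S₁ ⊆ ⋃ q ∈ (B.filter Nat.Prime), {v | (q : 𝓞 ℚ) ∈ v.asIdeal} := by
      intro v ⟨q, hqB, hq, hqv⟩
      simp only [Set.mem_iUnion, Finset.mem_filter]
      exact ⟨q, ⟨hqB, hq⟩, hqv⟩
    refine Set.Finite.subset (Set.Finite.biUnion (Finset.finite_toSet _) fun q hq ↦ ?_) this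
    rw [Finset.coe_filter, Set.mem_setOf_eq] at hq
    have hsub : {v : HeightOneSpectrum (𝓞 ℚ) | (q : 𝓞 ℚ) ∈ v.asIdeal}.Subsingleton :=
      fun v hv v' hv' ↦ HeightOneSpectrum.eq_of_natCast_mem_rat hq.2 hv hv'
    exact hsub.finite
  have hS₂fin : S₂.Finite := finite_setOf_not_isUnramifiedIn ℚ K
  have hS₃fin : S₃.Finite :=
    (hbad.union (Set.finite_iUnion fun i ↦ hTfin i)).image _
  set S := S₁ ∪ S₂ ∪ S₃ with hSdef
  have hSfin : S.Finite := (hS₁fin.union hS₂fin).union hS₃fin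
  -- ### Step D: Čebotarev in `Γ_ℚ`: a Frobenius in the open set `c₀ · res(ρ 𝒩)`
  have h𝒩open : IsOpen ((evalKer (W.baseChange K) ((p ^ M : ℕ) : ℤ) cs :
      Subgroup (absoluteGaloisGroup K)) : Set (absoluteGaloisGroup K)) :=
    isOpen_evalKer (W.baseChange K) _ cs (isOpen_torsionFixing (W.baseChange K) hn0)
  obtain ⟨O, hO⟩ : ∃ O : Set (absoluteGaloisGroup ℚ), O = (fun γ ↦ c₀ * γ) ''
      (absGaloisRestrict ℚ K '' ((fun m ↦ ρ * m) ''
        ((evalKer (W.baseChange K) ((p ^ M : ℕ) : ℤ) cs : Subgroup (absoluteGaloisGroup K)) :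
          Set (absoluteGaloisGroup K)))) := ⟨_, rfl⟩
  have hOopen : IsOpen O := by
    rw [hO]
    refine (Homeomorph.mulLeft c₀).isOpenMap _ (isOpenMap_absGaloisRestrict K _ ?_)
    exact (Homeomorph.mulLeft ρ).isOpenMap _ h𝒩open
  have hOne : O.Nonempty :=
    ⟨c₀ * absGaloisRestrict ℚ K (ρ * 1), hO ▸ ⟨_, ⟨_, ⟨1, Subgroup.one_mem _, rfl⟩, rfl⟩, rfl⟩⟩
  obtain ⟨γ, hγO, v, hvS, 𝔓₀, h𝔓₀, hγ⟩ :=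
    (absoluteGaloisGroup.frobenius_dense hC ℚ S hSfin).inter_open_nonempty O hOopen hOne
  rw [hO] at hγO
  obtain ⟨_, ⟨_, ⟨m, hm, rfl⟩, rfl⟩, rfl⟩ := hγO
  let g := ρ * m
  have hgτT : ht.conjGalCMH g * g ∈ torsionFixing (W.baseChange K) ((p ^ M : ℕ) : ℤ) :=
    conjGalCMH_mul_mul_mem_torsionFixing W ht hinv _ hρ2 hm.1
  -- ### Step E: the rational prime `ℓ` under `v`
  obtain ⟨ℓ, hℓ, hℓv⟩ := exists_prime_natCast_mem v
  have hℓB : ℓ ∉ B := fun h ↦ hvS (Or.inl (Or.inl ⟨ℓ, h, hℓ, hℓv⟩))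
  simp only [hB, Finset.mem_union, Finset.mem_singleton, Nat.mem_primeFactors,
    Finset.mem_range, not_or] at hℓB
  obtain ⟨⟨⟨hℓp, hℓN⟩, hℓD⟩, hℓb⟩ := hℓB
  have hℓN' : ¬ ℓ ∣ N := fun h ↦ hℓN ⟨hℓ, h, NeZero.ne N⟩
  have hℓD' : ¬ ((ℓ : ℤ) ∣ NumberField.discr K) := fun h ↦
    hℓD ⟨hℓ, Int.natAbs_dvd_natAbs.mpr h |>.trans (by simp), by
      simp [NumberField.discr_ne_zero]⟩
  have hbℓ : b < ℓ := by omega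
  have hunr : Algebra.IsUnramifiedIn (𝓞 K) v.asIdeal := by
    by_contra h; exact hvS (Or.inl (Or.inr h))
  have hvS₃ : v ∉ S₃ := fun h ↦ hvS (Or.inr h)
  -- ### Step F: `ℓ` is inert, with a Frobenius `τ' = g^τ g` over `K`
  have hHi := index_range_absGaloisRestrict_eq_finrank ℚ K
  haveI hHn : ((absGaloisRestrict ℚ K).range).Normal :=
    Subgroup.normal_of_index_eq_two (hHi.trans hK.1)
  have hI := inertia_le_range_absGaloisRestrict_of_isUnramifiedIn (K := K) hunr h𝔓₀
  have hΦH : c₀ * absGaloisRestrict ℚ K g ∉ (absGaloisRestrict ℚ K).range := by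
    intro h
    apply hc₀.not_mem_range_absGaloisRestrict (L := K) IsTotallyComplex.isComplex
    change c₀ ∈ ((absGaloisRestrict ℚ K).range : Set (absoluteGaloisGroup ℚ))
    have h' : c₀ = c₀ * absGaloisRestrict ℚ K g * (absGaloisRestrict ℚ K g)⁻¹ := by group
    rw [SetLike.mem_coe, h']
    exact Subgroup.mul_mem _ h (Subgroup.inv_mem _ ⟨g, rfl⟩)
  obtain ⟨w, 𝔔, τ', hwv, hwuniq, -, h𝔔w, -, hτ', hresτ'⟩ :=
    exists_place_inert_of_not_mem_range (F := ℚ) (M := K) (hK.1 ▸ Nat.prime_two) hHn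
      (hHi.trans rfl) hunr h𝔓₀ hI hγ hΦH
  rw [hK.1, sq_eq_absGaloisRestrict_conjGal_mul hc₀ ht g] at hresτ'
  have hτ'eq : τ' = ht.conjGalCMH g * g := absGaloisRestrict_injective ℚ K hresτ'
  -- `ℓ ∈ w`, and `w` is the only place of `K` containing `ℓ`
  have hℓw : (ℓ : 𝓞 K) ∈ w.asIdeal := by
    have h1 : (ℓ : 𝓞 ℚ) ∈ (w.under (𝓞 ℚ)).asIdeal := by rw [hwv]; exact hℓv
    rw [HeightOneSpectrum.under_asIdeal, Ideal.under_def, Ideal.mem_comap, map_natCast] at h1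
    exact h1
  have hwuniq' : ∀ w' : HeightOneSpectrum (𝓞 K), (ℓ : 𝓞 K) ∈ w'.asIdeal → w' = w := by
    intro w' hw'
    apply hwuniq
    apply HeightOneSpectrum.eq_of_natCast_mem_rat hℓ _ hℓv
    rw [HeightOneSpectrum.under_asIdeal, Ideal.under_def, Ideal.mem_comap, map_natCast]
    exact hw'
  -- `(ℓ) = w` is prime
  have hspan : Ideal.span {(ℓ : 𝓞 K)} = w.asIdeal := by
    apply span_natCast_eq_of_unique hℓ w hwuniq'
    haveI : w.asIdeal.LiesOver v.asIdeal := ⟨by rw [← hwv]; rfl⟩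
    have hmap : v.asIdeal.map (algebraMap (𝓞 ℚ) (𝓞 K)) = Ideal.span {(ℓ : 𝓞 K)} := by
      rw [← span_natCast_rat_eq hℓ hℓv, Ideal.map_span, Set.image_singleton, map_natCast]
    have hne : v.asIdeal.map (algebraMap (𝓞 ℚ) (𝓞 K)) ≠ ⊥ := by
      rw [hmap, Ne, Ideal.span_singleton_eq_bot]; exact_mod_cast hℓ.ne_zero
    rw [← hmap, ← Ideal.IsDedekindDomain.ramificationIdx_eq_normalizedFactors_count v.asIdeal
      w.asIdeal hne]
    exact Ideal.ramificationIdx_eq_one_iff.mpr (hunr w.asIdeal w.isPrime inferInstance)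
  -- ### Step G: the local criterion at `w`, for every class in the span of the `c_i`
  have hwT : ∀ i, w ∉ T i := fun i h ↦ hvS₃ ⟨w, Or.inr (Set.mem_iUnion.mpr ⟨i, h⟩), hwv⟩
  have hloc : ∀ x ∈ AddSubgroup.closure (Set.range cs),
      (x ∈ (W.baseChange K).torsionLocalKer (w.adicCompletion K) ((p ^ M : ℕ) : ℤ) ↔
        h1Eval (W.baseChange K) ((p ^ M : ℕ) : ℤ) x (ht.conjGalCMH (ρ * m) * (ρ * m)) = 0) := by
    intro x hx
    haveI : CharZero (w.adicCompletion K) :=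
      charZero_of_injective_algebraMap (algebraMap K (w.adicCompletion K)).injective
    obtain ⟨𝔐, h𝔐⟩ := w.localPrimesAbove_nonempty
    set 𝔓w := w.primeBelow (closureEmb (K := K) (w.adicCompletion K)) 𝔐 with h𝔓w_def
    have h𝔓w : 𝔓w ∈ w.primesAbove := w.primeBelow_mem_primesAbove h𝔐
    obtain ⟨δ, hδ, hF⟩ :=
      HeightOneSpectrum.exists_isArithFrobAt_conj_of_mem_primesAbove_holds h𝔔w h𝔓w hτ'
    have hτ'T : τ' ∈ torsionFixing (W.baseChange K) ((p ^ M : ℕ) : ℤ) := by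
      rw [hτ'eq]; exact hgτT
    have hFT : δ * τ' * δ⁻¹ ∈ torsionFixing (W.baseChange K) ((p ^ M : ℕ) : ℤ) :=
      (torsionFixing_normal (W.baseChange K) _).conj_mem _ hτ'T δ
    have hwbad : w ∉ (W.baseChange K).badPlaces (𝓞 K) := fun h ↦
      hvS₃ ⟨w, Or.inl h, hwv⟩
    have hpw : ((p : ℤ) : 𝓞 K) ∉ w.asIdeal := by
      rw [Int.cast_natCast]
      exact not_natCast_mem_of_prime_ne hℓ hp hℓp w hℓw
    have hpMw : ((((p ^ M : ℕ) : ℤ)) : 𝓞 K) ∉ w.asIdeal := fun h ↦ by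
      apply hpw
      rw [Int.cast_natCast, Nat.cast_pow] at h
      rw [Int.cast_natCast]
      exact w.isPrime.mem_of_pow_mem M h
    have hcrit := mem_torsionLocalKer_iff_h1Eval_eq_zero (W.baseChange K) ((p ^ M : ℕ) : ℤ) h𝔐 hF
      hFT (inertia_le_torsionFixing (W.baseChange K) hwbad hpMw _ h𝔐)
      (isOpen_torsionFixing (W.baseChange K) hn0)
      (torsionPointsMap_bijective (W.baseChange K) (w.adicCompletion K)
        (pow_ne_zero M hp.ne_zero)).2 (x := x)
      ((AddSubgroup.closure_le _).mpr (Set.range_subset_iff.mpr fun i ↦ hT i w (hwT i) 𝔓w h𝔓w)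
        hx)
    rw [hcrit, h1Eval_conj (W.baseChange K) _ _ δ hτ'T, smul_eq_zero_iff_eq, hτ'eq]
  -- ### Step H: assemble
  refine ⟨ℓ, hbℓ, hℓ, hℓN', hℓD', hℓp, hspan ▸ w.isPrime, m, hm, ⟨v, 𝔓₀, hℓv, h𝔓₀, hγ⟩,
    fun x hx v' hv' ↦ ?_⟩
  rw [hwuniq' v' hv']
  exact hloc x hx

end Cebotarev

end Summit.BirchSwinnertonDyer.BirchSwinnertonDyer.Theorems.PrintCFram.BorelTypeTwo

end
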